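import Summits.ABC.IUTFork.Cor312SettingPrVolM
import Summits.ABC.IUTFork.Cor312PilotIdelesMRead
import HarnessLib

/-!
# [IUTchIII] Corollary 3.12, statement — WEIGHTS AND EXPECTATIONS of the packet-normalised verbatim container of the
# M-LEVEL real log-shells (`K_{v̲}`, `v̲ ∈ V̲`) along `V̲_u ≅ V(F_mod)_p` (G1-Θ unit P2 of `HOME/staging/w5/w5-d166/g4/G1-THETA-SHAPES.md`)

PROOF-ONLY record file (D-0012; no definitions) of the abc-iut cell (seat abc-iut-w5-d244,
gen 8; branch C «abc ⇐ S», C-lead ruling C-R12 (e) «target #2′: the M-level (V̲, K_{v̲}) real volume setting»). TAKES NO SIDE on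
[IUTchIII] Cor. 3.12.

The G1-Θ route β (abc-iut-S3 07:44:48Z, C-R12 (e)) re-instantiates the Cor. 3.12 crew's real volume stack over abc-iut-c312-5's
M-LEVEL skeleton `Real.thetaIndexOfInitial D` / `Real.logShellsOfInitialDH D logvK` — the GENUINE carriers `K_{v̲}`,
`v̲ ∈ V̲ ≅ V_mod`, of [IUTchI] Def. 3.1 (e) (kurims `paper:url-690e7b3c6199` p. 62) = Dupuy–Hilado's "`K_{v̲}`" (Def. 3.6.1):
abc-iut-w5-d166's `p`-adic presentation `padicPresentationOfInitialDH` / `presAtM` (units P1, P2′: `Cor312VolumesPadicSummandsM`,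
`Cor312FrameVolumePiecesM`), abc-iut-s2's container `summandPiecesPrM` and setting `settingPrVolM` (unit P3,
`Cor312SettingPrVolM`), abc-iut-w5-d033's index identification `fibreEquivPlacesOverM : V̲_u ≃ V(F_mod)_p` (unit P4a,
`Cor312PilotIdelesMRead`). THIS FILE is the bookkeeping every M-level NUMBER runs through — the M-level twin of
abc-iut-c312-1's `Thm311RealDegreeFull` §1 and of abc-iut-c312-7's expectation identity `logvol_preimage_pi_Pr_of_last`
(`Cor312PilotIdelesPrNumbers` §1):

* §1 the container at a place, unfolded (`summandPiecesPrM_e/_logμ/_w`, `logvol_summandPiecesPrM_arc`);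
* §2 **WEIGHTS AND EXPECTATIONS along `V̲_u ≅ V(F_mod)_p`**: P1's summand weight `weightM` IS Dupuy–Hilado's tuple probability
  `Pr(v⃗) = Π_a n_{v_a}/[F_mod:ℚ]` (abc-iut-c312-3 `tupleWeights`, Dupuy–Hilado §3.6) read through the identification
  (`weightM_eq_tupleWeights_pr`); sums over the M-level summands ARE sums over `V(F_mod)_p^{j+1}` (`sum_fibreTuples_eq_sum_tuples`);
  the weights sum to `1` (`sum_weightM_eq_one`, `sum_w_summandPiecesPrM` — packet-normalisation, [IUTchIII] Rmk. 3.1.1 (ii),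
  kurims `paper:url-4b091feeb646` p. 94); and **the expectation identity** behind Dupuy–Hilado Thm. 3.10.1 (i):
  `Σ_{v⃗} Pr(v⃗)·c(v_j)·log N(v_j)/n_{v_j} = (1/[F_mod:ℚ])·Σ_{v ∈ V(F_mod)_p} c(v)·log N(v)` for ARBITRARY real coefficients `c` on the
  places of `F_mod` (`sum_weightM_mul_of_last`, container-free — serves the field-box setting `Cor312SettingMSharp` equally;
  `logvol_preimage_pi_PrM_of_last` for direct product regions of `summandPiecesPrM`) — the vehicle by which the M-level `q`-number
  becomes `−deĝ_{F_mod}(P_q)` (unit P5) and the M-level Θ-volumes meet abc-iut-S2's closed form over `V(F_mod)_p^{i+2}` (unit P6);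
* §3 `logvol_p_mul_PrM` — [IUTchIII] Prop. 3.9 (i) packet-normalisation HOLDS for the M-level container (`×p_u` costs `log p_u`;
  twin of abc-iut-c312-1's `logvol_p_mul_Pr`);
* §4 `adm_and_logvol_possibleImage_eq_PrM` — every possible image of the Θ-pilot object under a c312-7 `Cor312.Setting` over
  `situationPrVolM` is admissible with the Θ-region's log-volume ([IUTchIII] proof of Cor. 3.12, Step (x), p. 181; twin of
  abc-iut-c312-5's `adm_and_logvol_possibleImage_eq_DH`).

[cite: Mochizuki2012, IUTchI Def. 3.1 (e) p. 62] [cite: DupuyHilado2025, Def. 3.6.1, §3.6, Thm. 3.10.1, §4.9]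
[claim: Mochizuki2012, status: disputed] for the quoted container. HONEST FRAMING: bookkeeping over OUR typed objects; nothing here
bears on the truth of [IUTchIII] Cor. 3.12; no edit to P1 / P2′ / P3 / P4a or to any F-level file; typed ≠ proved; instantiated ≠
endorsed. Deliberately NOT here: Θ-boxes and `q`-centres read off abc-iut-S2's ideles (`Cor312SettingMSharp`, `Cor312PilotIdelesMRead`),
`ThetaFinite` (`Cor312ThetaFiniteM`), the numbers `−|log(q)|`, `−|log(Θ)|` at the M-level setting (units P5/P6), any judgement.
-/

noncomputable section

open Set Function NumberField IsDedekindDomain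
open scoped Pointwise

namespace Summit.ABC.IUTFork.Thm311.Real

open Cor312 Cor312Vol Literature.IUT.LogThetaLattice Literature.IUT.LogVolume Literature.IUT.HodgeTheaters
  Literature.NumberTheory.NumberFields

variable {F K Fbar : Type} [Field F] [NumberField F] [Field K] [NumberField K] [Algebra F K]
  [Field Fbar] [Algebra F Fbar] [Algebra K Fbar] {E : WeierstrassCurve F} [E.IsElliptic] {l : ℕ}
  {Pb : BadPlacePredicates K} (D : InitialThetaData F K Fbar E l Pb) {logvK : PadicLogsVal K}
  (hlog : LogvAnalyticVal logvK)

/-! ## §1. The packet-normalised verbatim container at a place, unfolded -/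

/-- The comparison of the container at a finite place `u` IS P1's `comparison` (definitional). [folklore] -/
theorem summandPiecesPrM_e (j : (thetaIndexOfInitial D).Label) (u : FinitePlace ℚ) :
    (summandPiecesPrM D hlog).e j (Val.non u) = ⇑((presAtM D hlog u).comparison j) := rfl

/-- The log-measure of the container at a finite place `u` is abc-iut-c312-3's normalised `packetLogμ` (definitional). [folklore] -/
theorem summandPiecesPrM_logμ (j : (thetaIndexOfInitial D).Label) (u : FinitePlace ℚ)
    (e : (summandPiecesPrM D hlog).E j (Val.non u)) (A : Set ((presAtM D hlog u).X e)) :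
    (summandPiecesPrM D hlog).logμ j (Val.non u) e A = packetLogμ (ratChar u) ((presAtM D hlog u).kk e) A := rfl

/-- The weights of the container at a finite place `u` are P1's `weightM` (definitional). [folklore] -/
theorem summandPiecesPrM_w (j : (thetaIndexOfInitial D).Label) (u : FinitePlace ℚ)
    (e : (summandPiecesPrM D hlog).E j (Val.non u)) :
    (summandPiecesPrM D hlog).w j (Val.non u) e = weightM D u j e := rfl

/-- The log-volume of the container at an archimedean place vanishes (trivial container). [folklore] -/
theorem logvol_summandPiecesPrM_arc (j : (thetaIndexOfInitial D).Label) (w : InfinitePlace ℚ)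
    (A : Set ((logShellsOfInitialDH D logvK).Packet j (Val.arc w))) :
    (summandPiecesPrM D hlog).logvol j (Val.arc w) A = 0 := by
  refine Finset.sum_eq_zero fun e _ => ?_
  show (0 : ℝ) * 0 = 0
  simp

/-! ## §2. Weights and expectations along `V̲_u ≅ V(F_mod)_p` -/

section Weights

variable (p : ℕ) [hp : Fact p.Prime] (u : FinitePlace ℚ) (hu : ((p : ℕ) : 𝓞 ℚ) ∈ (FinitePlace.maximalIdeal u).asIdeal)

include hu in
omit hlog in
/-- **P1's summand weight IS Dupuy–Hilado's tuple probability** read through abc-iut-w5-d033's identification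
`V̲_u ≅ V(F_mod)_p`: `w(v̲⃗) = Pr(v⃗) = Π_a n_{v_a}/[F_mod:ℚ]` (abc-iut-c312-3 `tupleWeights`; Dupuy–Hilado §3.6 "Since products of
probability spaces are probability spaces the sets `V(F₀)_p^{r+1}` also have the natural structure of a probability space").
[cite: DupuyHilado2025, §3.6] -/
theorem weightM_eq_tupleWeights_pr (j : (thetaIndexOfInitial D).Label)
    (e : (thetaIndexOfInitial D).Caps j → (thetaIndexOfInitial D).Fibre (Val.non u)) :
    weightM D u j e = (tupleWeights (fieldOfModuli E) p (j : ℕ)).pr (fun a => fibreEquivPlacesOverM D p u hu (e a)) := rfl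

include hu in
omit hlog in
/-- **Sums over the M-level summands ARE sums over `V(F_mod)_p^{j+1}`** (re-indexing along `fibreEquivPlacesOverM`, tuple by
tuple). [cite: Mochizuki2012, IUTchI Def. 3.1 (e) p. 62] -/
theorem sum_fibreTuples_eq_sum_tuples {M : Type*} [AddCommMonoid M] (j : (thetaIndexOfInitial D).Label)
    (f : (Fin ((j : ℕ) + 1) → ↥(placesOver (fieldOfModuli E) p)) → M) :
    letI : Fintype ((thetaIndexOfInitial D).Caps j → (thetaIndexOfInitial D).Fibre (Val.non u)) := Fintype.ofFinite _
    ∑ e : (thetaIndexOfInitial D).Caps j → (thetaIndexOfInitial D).Fibre (Val.non u),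
        f (fun a => fibreEquivPlacesOverM D p u hu (e a)) =
      ∑ e' : Fin ((j : ℕ) + 1) → ↥(placesOver (fieldOfModuli E) p), f e' := by
  letI : Fintype ((thetaIndexOfInitial D).Caps j → (thetaIndexOfInitial D).Fibre (Val.non u)) := Fintype.ofFinite _
  exact Fintype.sum_equiv (Equiv.arrowCongr (Equiv.refl _) (fibreEquivPlacesOverM D p u hu)) _ _ fun _ => rfl

include hu in
omit hlog in
/-- **The M-level summand weights over `u ∋ p` sum to `1`** (`Σ_{v⃗ ∈ V(F_mod)_p^{j+1}} Pr(v⃗) = 1`, abc-iut-c312-3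
`ProbWeights.sum_pr`) — the packet-normalisation of [IUTchIII] Rmk. 3.1.1 (ii) at the M level. [cite: DupuyHilado2025, §3.6] -/
theorem sum_weightM_eq_one (j : (thetaIndexOfInitial D).Label) :
    letI : Fintype ((thetaIndexOfInitial D).Caps j → (thetaIndexOfInitial D).Fibre (Val.non u)) := Fintype.ofFinite _
    ∑ e : (thetaIndexOfInitial D).Caps j → (thetaIndexOfInitial D).Fibre (Val.non u), weightM D u j e = 1 := by
  rw [← (tupleWeights (fieldOfModuli E) p (j : ℕ)).sum_pr]
  exact sum_fibreTuples_eq_sum_tuples D p u hu j (tupleWeights (fieldOfModuli E) p (j : ℕ)).pr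

include hu in
omit hlog in
/-- **THE EXPECTATION IDENTITY** (Dupuy–Hilado's proof of Thm. 3.10.1 (i) at one prime, M level): for real coefficients `c` on
the places of `F_mod`, `Σ_{v̲⃗} w(v̲⃗)·c(v_j)·log N(v_j)/n_{v_j} = (1/[F_mod:ℚ])·Σ_{v ∈ V(F_mod)_p} c(v)·log N(v)` — "`𝔼(ln|t_{v_{r−1}}|_p :
(v_0,…,v_{r−1}) ∈ V(F₀)_p^r) = 𝔼(ln|t_v|_p : v ∈ V(F₀)_p)`" (abc-iut-c312-3 `tupleWeights_expect_coord`), then `Pr(v)/n_v = 1/[F₀:ℚ]`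
(`expect_neg_deg_div_localDegree'`), with `F₀ = F_mod` and the last place `v_j` read under the member `v̲_j` of the fibre.
Container-free form (weights only). [cite: DupuyHilado2025, Thm. 3.10.1] -/
theorem sum_weightM_mul_of_last (j : (thetaIndexOfInitial D).Label) (c : HeightOneSpectrum (𝓞 (fieldOfModuli E)) → ℝ) :
    letI : Fintype ((thetaIndexOfInitial D).Caps j → (thetaIndexOfInitial D).Fibre (Val.non u)) := Fintype.ofFinite _
    ∑ e : (thetaIndexOfInitial D).Caps j → (thetaIndexOfInitial D).Fibre (Val.non u),
        weightM D u j e *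
          (c (placeModOfM D u (e (Fin.last _))) * logNorm (fieldOfModuli E) (placeModOfM D u (e (Fin.last _))) /
            localDegree (fieldOfModuli E) (placeModOfM D u (e (Fin.last _)))) =
      (∑ v ∈ placesOver (fieldOfModuli E) p, c v * logNorm (fieldOfModuli E) v) / Module.finrank ℚ (fieldOfModuli E) := by
  letI : Fintype ((thetaIndexOfInitial D).Caps j → (thetaIndexOfInitial D).Fibre (Val.non u)) := Fintype.ofFinite _
  refine Eq.trans (b := ∑ e' : Fin ((j : ℕ) + 1) → ↥(placesOver (fieldOfModuli E) p),
    c (e' (Fin.last _)).1 * logNorm (fieldOfModuli E) (e' (Fin.last _)).1 / localDegree (fieldOfModuli E) (e' (Fin.last _)).1 *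
      (tupleWeights (fieldOfModuli E) p (j : ℕ)).pr e') ?_ ?_
  · refine Eq.trans ?_ (sum_fibreTuples_eq_sum_tuples D p u hu j fun e' =>
      c (e' (Fin.last _)).1 * logNorm (fieldOfModuli E) (e' (Fin.last _)).1 / localDegree (fieldOfModuli E) (e' (Fin.last _)).1 *
        (tupleWeights (fieldOfModuli E) p (j : ℕ)).pr e')
    exact Finset.sum_congr rfl fun e _ => by rw [mul_comm]; rfl
  refine (tupleWeights_expect_coord (fieldOfModuli E) p (j : ℕ) (Fin.last _)
    (fun v : placesOver (fieldOfModuli E) p =>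
      c v.1 * logNorm (fieldOfModuli E) v.1 / localDegree (fieldOfModuli E) v.1)).trans ?_
  have h2 := expect_neg_deg_div_localDegree' (fieldOfModuli E) p fun v => -c v.1
  simp only [neg_mul, neg_neg] at h2
  rw [h2, FinDivisor.ndeg_apply, map_sum, ← neg_div, ← Finset.sum_neg_distrib]
  congr 1
  rw [← Finset.sum_coe_sort (placesOver (fieldOfModuli E) p)]
  refine Finset.sum_congr rfl fun v _ => ?_
  rw [FinDivisor.deg_of]
  ring

end Weights

/-- **The container weights at `u` sum to `1`** (`summandPiecesPrM` is packet-normalised). [cite: DupuyHilado2025, §3.6] -/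
theorem sum_w_summandPiecesPrM (j : (thetaIndexOfInitial D).Label) (u : FinitePlace ℚ) :
    ∑ e, (summandPiecesPrM D hlog).w j (Val.non u) e = 1 :=
  sum_weightM_eq_one D (ratChar u) u (natCast_ratChar_mem u) j

/-- **Direct product regions of the M-level container whose summand log-measures depend on the LAST place through
`c(v)·log N(v)/n_v` have log-volume `(1/[F_mod:ℚ])·Σ_{v ∈ V(F_mod)_{p_u}} c(v)·log N(v)`** — the M-level twin of abc-iut-c312-7's
`logvol_preimage_pi_Pr_of_last` (the pattern of abc-iut-c312-1's `logvol_idealRegion_inr`), for ARBITRARY real coefficients on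
the places of `F_mod`: the vehicle for "`−|log(q)| = −deĝ(P_q)`" over `F_mod` at the M-level setting.
[cite: DupuyHilado2025, Thm. 3.10.1] -/
theorem logvol_preimage_pi_PrM_of_last (u : FinitePlace ℚ) (j : (thetaIndexOfInitial D).Label)
    (R : ∀ e : (thetaIndexOfInitial D).Caps j → (thetaIndexOfInitial D).Fibre (Val.non u), Set ((presAtM D hlog u).X e))
    (hR : ∀ e, PacketAdm (ratChar u) ((presAtM D hlog u).kk e) (R e))
    (c : HeightOneSpectrum (𝓞 (fieldOfModuli E)) → ℝ)
    (hc : ∀ e, packetLogμ (ratChar u) ((presAtM D hlog u).kk e) (R e) =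
      c (placeModOfM D u (e (Fin.last _))) * logNorm (fieldOfModuli E) (placeModOfM D u (e (Fin.last _))) /
        localDegree (fieldOfModuli E) (placeModOfM D u (e (Fin.last _)))) :
    (summandPiecesPrM D hlog).logvol j (Val.non u) ((presAtM D hlog u).comparison j ⁻¹' Set.pi univ R) =
      (∑ v ∈ placesOver (fieldOfModuli E) (ratChar u), c v * logNorm (fieldOfModuli E) v) /
        Module.finrank ℚ (fieldOfModuli E) := by
  have hμ : ∀ e, (summandPiecesPrM D hlog).logμ j (Val.non u) e (R e) =
      c (placeModOfM D u (e (Fin.last _))) * logNorm (fieldOfModuli E) (placeModOfM D u (e (Fin.last _))) /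
        localDegree (fieldOfModuli E) (placeModOfM D u (e (Fin.last _))) := fun e => hc e
  show (summandPiecesPrM D hlog).logvol j (Val.non u) ((summandPiecesPrM D hlog).e j (Val.non u) ⁻¹' Set.pi univ R) = _
  rw [(summandPiecesPrM D hlog).logvol_preimage_pi j (Val.non u) (R := R) hR]
  simp only [hμ]
  exact sum_weightM_mul_of_last D (ratChar u) u (natCast_ratChar_mem u) j c

/-! ## §3. Packet-normalisation: `×p` costs `log p` -/

/-- **[IUTchIII] Prop. 3.9 (i) packet-normalisation HOLDS for the M-level container**: for a direct product region
`e⁻¹(Π_{v̲⃗} R_{v̲⃗})` over `u` with admissible factors, multiplying every factor by `p_u` (abc-iut-c312-3's `ppow p _ 1`) subtracts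
exactly `log p_u` from the log-volume ("multiplication … by `p_v` corresponds to adding the quantity `−log(p_v)`", p. 115; Rmk. 3.1.1
(ii) p. 94) — the M-level twin of abc-iut-c312-1's `logvol_p_mul_Pr`. [claim: Mochizuki2012, status: disputed] -/
theorem logvol_p_mul_PrM (u : FinitePlace ℚ) (j : (thetaIndexOfInitial D).Label)
    (R : ∀ e : (summandPiecesPrM D hlog).E j (Val.non u), Set ((presAtM D hlog u).X e))
    (hR : ∀ e, PacketAdm (ratChar u) ((presAtM D hlog u).kk e) (R e)) :
    (summandPiecesPrM D hlog).logvol j (Val.non u)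
        ((summandPiecesPrM D hlog).e j (Val.non u) ⁻¹' Set.pi univ fun e =>
          ppow (ratChar u) ((presAtM D hlog u).kk e) 1 • R e) =
      (summandPiecesPrM D hlog).logvol j (Val.non u) ((summandPiecesPrM D hlog).e j (Val.non u) ⁻¹' Set.pi univ R) -
        Real.log (ratChar u) := by
  have hR' : ∀ e, PacketAdm (ratChar u) ((presAtM D hlog u).kk e) (ppow (ratChar u) ((presAtM D hlog u).kk e) 1 • R e) :=
    fun e => packetAdm_smul (ratChar u) _ _ (fun jx => by
      rw [psi_ppow_apply]; exact zpow_ne_zero _ (prime_ne_zero (ratChar u) (DFac (ratChar u) _ jx))) (hR e)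
  rw [(summandPiecesPrM D hlog).logvol_preimage_pi j (Val.non u) hR',
    (summandPiecesPrM D hlog).logvol_preimage_pi j (Val.non u) hR]
  have hμ : ∀ e, (summandPiecesPrM D hlog).logμ j (Val.non u) e (ppow (ratChar u) ((presAtM D hlog u).kk e) 1 • R e) =
      -((1 : ℤ) * Real.log (ratChar u)) + (summandPiecesPrM D hlog).logμ j (Val.non u) e (R e) := fun e =>
    packetLogμ_ppow_smul (ratChar u) _ 1 (hR e)
  simp only [hμ, mul_add, Finset.sum_add_distrib, Int.cast_one, one_mul, mul_neg, Finset.sum_neg_distrib,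
    ← Finset.sum_mul, sum_w_summandPiecesPrM D hlog j u]
  ring

/-! ## §4. Possible images under a setting over the M-level situation -/

section Consequences

variable (M : Type) [Field M] [NumberField M]
  (archPk : ∀ (j : (thetaIndexOfInitial D).Label) (vQ : (thetaIndexOfInitial D).VQ),
    Set ((logShellsOfInitialDH D logvK).Packet j vQ))
  (archSub : ∀ (j : (thetaIndexOfInitial D).Label) (v : (thetaIndexOfInitial D).V),
    Set ((logShellsOfInitialDH D logvK).Packet j ((thetaIndexOfInitial D).over v)))
  (Ψ : ℤ → ∀ v : (thetaIndexOfInitial D).V, v ∈ (thetaIndexOfInitial D).Vbad →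
    Set ((logShellsOfInitialDH D logvK).StarPacket v))
  (act : ℤ → ∀ v : (thetaIndexOfInitial D).V, v ∈ (thetaIndexOfInitial D).Vbad →
    (logShellsOfInitialDH D logvK).StarPacket v → Module.End ℚ ((logShellsOfInitialDH D logvK).StarPacket v))
  (Mmod : ℤ → ∀ j : (thetaIndexOfInitial D).LabelStar, Set ((logShellsOfInitialDH D logvK).GlobalPacket j.1))
  (region : ℤ → ∀ j : (thetaIndexOfInitial D).LabelStar, FinDivisor M → ∀ vQ : (thetaIndexOfInitial D).VQ,
    Set ((logShellsOfInitialDH D logvK).Packet j.1 vQ))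

variable (P : Cor312.Setting (situationPrVolM D hlog M archPk archSub Ψ act Mmod region))

/-- **Every possible image of the Θ-pilot object is admissible with the Θ-region's log-volume**, for any abc-iut-c312-7
`Cor312.Setting` over the M-level situation with the packet-normalised volumes, as soon as the (Ind3)-enlarged Θ-region itself
is admissible ([IUTchIII] Cor. 3.12 "the union of the possible images … subject to (Ind1), (Ind2), (Ind3)"; proof Step (x)).
[claim: Mochizuki2012, status: disputed] -/
theorem adm_and_logvol_possibleImage_eq_PrM {j : (thetaIndexOfInitial D).Label} {vQ : (thetaIndexOfInitial D).VQ}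
    (hθ : ((situationPrVolM D hlog M archPk archSub Ψ act Mmod region).D P.n).Adm j vQ (P.thetaRegion3 j vQ))
    {U : Set ((logShellsOfInitialDH D logvK).Packet j vQ)} (hU : U ∈ P.possibleImages j vQ) :
    ((situationPrVolM D hlog M archPk archSub Ψ act Mmod region).D P.n).Adm j vQ U ∧
      ((situationPrVolM D hlog M archPk archSub Ψ act Mmod region).D P.n).logvol j vQ U =
        ((situationPrVolM D hlog M archPk archSub Ψ act Mmod region).D P.n).logvol j vQ (P.thetaRegion3 j vQ) :=
  SummandPieces.adm_and_logvol_possibleImage_eq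
    (realizes_situationPrVolM D hlog M archPk archSub Ψ act Mmod region P.n)
    (generatorsPreserve_summandPiecesPrM D hlog) hθ hU

end Consequences

end Summit.ABC.IUTFork.Thm311.Real

end
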